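import Mathlib
import Literature.MathematicalPhysics.QuantumFieldTheory.Balaban1983to89.B8

/-!
# `Balaban1983to89.B11` — T. Bałaban, *The variational problem and background fields in renormalization group
method for lattice gauge theories* (title as printed on p. 277; running head "Variational Problem and Background Fields
for Lattice Gauge Theories"), Commun. Math. Phys. **102**, 277–309 (1985), doi:10.1007/bf01229381.  (Cell numbering: B11; = ref. [15] of
[Balaban1987RG1]; its refs [2]–[6] = B5, B6, B7, B9, B8 of the cell; [1] = Physica 124A (1984).)
PDF held: `paper:balaban1985-cmp102-variational-background` (journal page = PDF page + 276).

CITATION HEADER (lean-in-tree rule 2026-08-18).  This module is a TYPED SKELETON (statement level) of the published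
paper [Balaban1985Variational] (cell paper B11).  WHAT IS REPRODUCED: Theorem 1 (p. 279) VERBATIM with its hypothesis
(7) and the spaces (2), (3), (6), (8) (p. 278), the regularity conclusions (9)–(10), and the shape of the imported
remark "by Proposition 2 [4] the configuration V satisfies (7) with ε₁ = O(ε₀)" ([4] = [Balaban1985Averaging]), each as
a `def … : Prop` over an abstract carrier whose fields NAME the printed spaces, functionals and norms; the quantifier
order of the constants is made explicit ("a₀, a₁, B₃ depend on d and L only" — the functional (5) carries η^{d−4}, so
d = 3 and d = 4 are both covered: constants chosen BEFORE the instance of the family).  NOTHING of the series is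
asserted: this is the LOAD-BEARING LEAF for everything downstream — the minimal configurations `U_k(V)` (background
fields) entering (0.22) of [Balaban1987RG1], (2.18) of [Balaban1988Convergent], (0.1) of [Balaban1989LargeFieldII] —
and `Thm1Printed` is consumed there only as a hypothesis.  The later sections' results (analyticity in V, expansions —
"we defer their formulations to the last section", p. 279) were not typed by r2; the surge unit `b2b-balaban-b11`
(2026-08-18) appends them below (`## Surge nodes`: Propositions 2–9 verbatim, the Sect. F conclusion, and the
paper-internal bookkeeping Thm 1 ⇐ Prop 7 + Prop 8 + Sect. F), importing `…Balaban1983to89.B8` for the typed edge to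
[6] Thm 2 / Prop 3.  Why a local carrier and not the shared
`Setup` vocabulary (`…Balaban1983to89.Setup`): the theorem quantifies over the nested geometric data (k; Ω₀ ⊃ Ω₁ ⊃ … ⊃
Ω_k, Λ_j, 𝔅_k), gauge transformations on neighbourhoods of cubes and four norm functionals of the field A with
U^{u⁻¹} = e^{iηA}, none of which `Setup` models (its `GaugeField`/`plaqDev` describe one periodic lattice); the carrier
only names them, so no `Setup` definition is restated.  Staged byte-identically in the cell package
`run/shared/lean/pub/pub-balaban/lean/BalabanYm4/Literature/…/B11.lean` (legacy copy `BalabanYm4/B11.lean` there,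
namespace `BalabanYm4.B11`, same declarations).  Unit `b2b-balaban-r2` (reader group B+C); companion prose
`HOME/b2b-balaban-r2/B11.md`; census GAPS.md G-r2.2 (the dependence M(ε₁) = R₁M₁(a₁/ε₁) and "B₄(β₀) depends on the
indicated parameters also").
-/

namespace Literature.MathematicalPhysics.QuantumFieldTheory.Balaban1983to89.B11

/-- Abstract carrier of the variational problem for fixed (d, L) and a fixed geometric datum (k; Ω₀ ⊃ Ω₁ ⊃ … ⊃ Ω_k,
the sets Λ_j, 𝔅_k) (p. 278 [2]): configurations `U` on Ω₀ (spacing η = L^{-k}), boundary data `V` on 𝔅_k, cubes □ of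
the class of Sect. F of [Balaban1984PropagatorsII] with their scale index j (`scale`) and size parameter M (`sizeM`: □
has size 2ML^jη); `InU ε₀ U` : U ∈ 𝔘_k({Ω_j}, ε₀), conditions (2) "|U(∂p) − 1| < ε₀ η²(L^jη)^{−2} for p ∈ Ω_j,
|(D*_U ∂U)(b)| < ε₀ η²(L^jη)^{−3} for b ∈ Ω_j, j = 0,…,k"; `InB V U` : U ∈ 𝔅_k(𝔅_k, V), condition (3) "Ū^j = V on
Λ_j"; `Reg7 ε₁ V` : hypothesis (7) "|(∂V)(p′) − 1| < ε₁ for p′ ∈ 𝔅_k"; `OnMinimalOrbit e V U` : "U lies on a minimal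
orbit of the functional (5) A(U) = Σ_{p⊂Ω₀} η^{d−4}[1 − Re tr U(∂p)] in the space 𝔘_k({Ω_j}, e) ∩ 𝔅_k(𝔅_k, V)";
`UniqueCriticalOrbit ε₀ V U` : "the orbit of U is the unique critical orbit of (5) in the space (6) = 𝔘_k({Ω_j}, ε₀) ∩
𝔅_k(𝔅_k, V)"; `Gauged U □` : existence of the gauge transformation u of the theorem on a neighbourhood of □ with
U^{u⁻¹} = e^{iηA}, and the sup-norms on □ of that A: `normA` = |A|, `normGradA` = |∇^η A|, `holderA · · β` = ‖A‖_{1,β},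
`normLapA` = max(|∂^{η*}∂^η A|, |Δ^η A|). [cite: Balaban1985Variational, (2)–(8) p.278] -/
structure VarProblem where
  Cfg : Type
  Bdry : Type
  Cube : Type
  scale : Cube → ℕ
  sizeM : Cube → ℝ
  eta : ℝ
  L : ℝ
  InU : ℝ → Cfg → Prop
  InB : Bdry → Cfg → Prop
  Reg7 : ℝ → Bdry → Prop
  OnMinimalOrbit : ℝ → Bdry → Cfg → Prop
  UniqueCriticalOrbit : ℝ → Bdry → Cfg → Prop
  Gauged : Cfg → Cube → Prop
  normA : Cfg → Cube → ℝ
  normGradA : Cfg → Cube → ℝ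
  holderA : Cfg → Cube → ℝ → ℝ
  normLapA : Cfg → Cube → ℝ

/-- The regularity conclusions **(9), (10)** p. 279 [3], verbatim, for a minimal configuration `U` and a cube □ of
size 2ML^jη: *"|A| < B₃ M ε₁ (L^jη)^{−1}, |∇^η A| < B₃ M ε₁ (L^jη)^{−2}, ‖A‖_{1,β} < B₄(β₀) M ε₁ (L^jη)^{−2−β} for
0 ≤ β ≤ β₀ = 1, (9)  |∂^{η*}∂^η A|, |Δ^η A| < B₃ M ε₁ (L^jη)^{−3}. (10)"*. [cite: Balaban1985Variational, (9)–(10) p.279] -/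
def Regularity (P : VarProblem) (B₃ B₄ ε₁ : ℝ) (U : P.Cfg) (c : P.Cube) : Prop :=
  P.Gauged U c ∧
  P.normA U c < B₃ * P.sizeM c * ε₁ * (P.L ^ P.scale c * P.eta)⁻¹ ^ 1 ∧
  P.normGradA U c < B₃ * P.sizeM c * ε₁ * (P.L ^ P.scale c * P.eta)⁻¹ ^ 2 ∧
  (∀ β : ℝ, 0 ≤ β → β ≤ 1 →
    P.holderA U c β < B₄ * P.sizeM c * ε₁ * ((P.L ^ P.scale c * P.eta)⁻¹) ^ (2 + β)) ∧
  P.normLapA U c < B₃ * P.sizeM c * ε₁ * (P.L ^ P.scale c * P.eta)⁻¹ ^ 3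

/-- **Theorem 1**, verbatim (p. 279 [3]): *"There exist positive constants a₀, a₁, B₃, B₄(β₀), M(ε₁), B₃a₁ ≤ a₀, such
that for an arbitrary configuration V satisfying (7) with ε₁ ≤ a₁ there exists a minimal orbit in the space
𝔘_k({Ω_j}, B₃ε₁) ∩ 𝔅_k(𝔅_k, V). (8)  This orbit is a unique critical orbit in the space (6) if B₃ε₁ ≤ ε₀ and ε₀ ≤ a₀.
The minimal configurations U have the following regularity properties: for an arbitrary cube □ in the class described
above, of a size 2ML^jη, M ≤ M(ε₁), there exists a gauge transformation u defined on a neighborhood of □ and such that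
on □, U^{u⁻¹} = e^{iηA}, [(9), (10)].  The constants a₀, a₁, B₃ depend on d and L only, the constants B₄(β₀), M(ε₁)
depend on the indicated parameters also. More exactly M(ε₁) = R₁M₁(a₁/ε₁)."*
Quantifier order typed: the family of variational problems for fixed (d, L) is indexed by an arbitrary type `I`
(k, {Ω_j}, 𝔅_k, torus); a₀, a₁, B₃, B₄ (β₀ = 1 fixed) and the function M(·) are chosen BEFORE `i : I`, before V and
before ε₁, ε₀. [cite: Balaban1985Variational, Thm 1 p.279] -/
def Thm1Printed {I : Type} (fam : I → VarProblem) : Prop :=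
  ∃ a₀ a₁ B₃ B₄ : ℝ, ∃ Mfun : ℝ → ℝ,
    0 < a₀ ∧ 0 < a₁ ∧ 0 < B₃ ∧ 0 < B₄ ∧ B₃ * a₁ ≤ a₀ ∧ (∀ e, 0 < e → 0 < Mfun e) ∧
    ∀ i : I, ∀ ε₁ : ℝ, 0 < ε₁ → ε₁ ≤ a₁ → ∀ V : (fam i).Bdry, (fam i).Reg7 ε₁ V →
      (∃ U : (fam i).Cfg, (fam i).InU (B₃ * ε₁) U ∧ (fam i).InB V U ∧ (fam i).OnMinimalOrbit (B₃ * ε₁) V U) ∧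
      (∀ ε₀ : ℝ, B₃ * ε₁ ≤ ε₀ → ε₀ ≤ a₀ →
        ∀ U, (fam i).OnMinimalOrbit (B₃ * ε₁) V U → (fam i).UniqueCriticalOrbit ε₀ V U) ∧
      (∀ U, (fam i).OnMinimalOrbit (B₃ * ε₁) V U →
        ∀ c : (fam i).Cube, (fam i).sizeM c ≤ Mfun ε₁ → Regularity (fam i) B₃ B₄ ε₁ U c)

/-- p. 278 [2], verbatim: *"Let us notice that if the space (6) is non-empty and ε₀ is sufficiently small, then by
Proposition 2 [4] the configuration V satisfies (7) with ε₁ = O(ε₀). Hence our assumption has a meaning only for ε₁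
smaller than ε₀."*  ([4] = [Balaban1985Averaging], Proposition 2 — typed in the tree as `…Balaban1983to89.B7.Prop2Printed`
over that paper's own carrier; here only the SHAPE in which B11 imports it, for fixed (d, L): constants before the
instance.) [cite: Balaban1985Variational, remark after (7) p.278] -/
def Prop2OfB7Shape {I : Type} (fam : I → VarProblem) : Prop :=
  ∃ c₇ a₇ : ℝ, 0 < c₇ ∧ 0 < a₇ ∧ ∀ i : I, ∀ ε₀ : ℝ, 0 < ε₀ → ε₀ ≤ a₇ → ∀ V : (fam i).Bdry,
    (∃ U, (fam i).InU ε₀ U ∧ (fam i).InB V U) → (fam i).Reg7 (c₇ * ε₀) V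

/-! ## Surge nodes (b2b-balaban-b11, 2026-08-18): Propositions 2–9 verbatim + paper-internal bookkeeping

Journal page = PDF page + 276.  References of the paper: [2] = B5 `Balaban1984PropagatorsI`, [3] = B6
`Balaban1984PropagatorsII`, [4] = B7 `Balaban1985Averaging`, [5] = B9 `Balaban1985BackgroundPropagators`,
[6] = B8 `Balaban1985RegularSpaces` (p. 309).  Everything below is a TYPED SKELETON of the printed statements
(each `…Printed` is a `Prop`, used only as a hypothesis) plus kernel-checked bookkeeping between them; the
located proof gaps are recorded in the pub-balaban cell file GAPS.md (rows G-B11-*, C-B11-*) and the typed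
readings in DIVERGENCE.md (rows D-B11-*).  Value = typed skeleton + located gaps, NOT summit progress. -/

section SurgeB11

variable {I : Type}

/-! ### Sect. A–E carrier (Landau gauge around a background U₀) -/

/-- Abstract carrier of Sects. A–E (pp. 279–300 [3–24]) for fixed (d, L), a fixed geometric datum (k; {Ω_j}; Λ_j;
𝔅_k) and η = L^{−k}: `Cfg` = configurations U₀ on Ω₀; `Bdry` = data V on 𝔅_k; `Pert` = configurations U′, U₁
(U = U′U₀ (15), U₁ = U′^{u⁻¹} = e^{iηA}); `GT` = gauge transformations u; `Fld` = 𝔤ᶜ-valued vector fields A′, A₁,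
𝔄 on Ω₀; `Cell` = elements c of 𝔅_k with scale `cscale`; `Site` = points y ∈ Λ_j with `scale y = j`;
`dist c y` = d(c₋, y), `dim` = d.
* `Sat14 a b V U₀` = hypothesis (14) p. 279 with its two parameters displayed: "U₀ ∈ 𝔘_k({Ω_j}, a),
  |Ū₀^j − V| < b on Λ_j, j = 0, …, k" (printed with a = C₁B₃ε₁, b = C₁ε₁; "The configuration U₀ constructed
  above satisfies (14) with C₁ = L³"), read together with p. 280 "The additional regularity condition (3.35) in
  (1.33) is satisfied for U₀ also, because of the result of Sect. F" (= Sect. F of [6], i.e. B8 Prop. 6; cf.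
  p. 296 "the results of [6], especially those of the Sect. F");
* `In18 ε₀ V U₀ U′` = U′U₀ ∈ 𝔘_k({Ω_j}, ε₀) ∩ 𝔅_k(𝔅_k, V) ∩ Ax_k(𝔅_k, U₀) (18); `Crit V U₀ U′` = "U′U₀ is a
  critical configuration of the functional (5)" (on the constraint manifold 𝔅_k(𝔅_k, V) (3));
* `In19_21 ε₂ V U₀ U₁` = U₁ = e^{iηA} satisfies (19)–(21) with parameter ε₂: "|A| < ε₂(L^jη)^{−1},
  |∇^η_{U₀}A| < ε₂(L^jη)^{−2}, |D^{η*}_{U₀}D^η_{U₀}A|, |Δ^η_{U₀}A| < ε₂(L^jη)^{−3} on Ω_j (19), Q_j(U₀, ηA) = B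
  on Λ_j (20) [B determined by V, U₀ through (1.31) of [6], |B| < 2dLC₁ε₁], R(U₀)D^{η*}_{U₀}A = 0 (21)";
  `CritL V U₀ U₁` = "U₁ is a critical configuration of the functional A(U₁U₀) in the space (19)–(21)";
* `Restricted U₀ u` = "\overline{R₀u}^j = 1 on Λ_j, j = 0, …, k"; `toAxial U₀ U₁ u` = the configuration U′ with
  U′U₀ = (U₁U₀)^u ((16), p. 280 and p. 299);
* Sect. C: `In43 U₀ ε A′` = A′ lies in the set (43) with parameter ε; `nM1 U₀ A′` = |A′|_{(−1)}; `Def47 U₀ ε` =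
  "the transformation A = A′ − HD(A′) (47) is defined and analytic on the set (43) with parameter ε";
  `T47 U₀ A′` = A′ − HD(A′); `normD U₀ A′` = |D(A′)|; `kerD U₀ A′ c y` = sup_{b ∈ B^j(y)} |𝔇(A′; c, b)|,
  𝔇 = (δ/δA)D (70);
* Sect. D–E: `nMax U₀ A′` = max{|A′|_{(−1)}, |∇A′|_{(−2)}} ((77), (104), (115)); `dVn U₀ A′` =
  |((δ/δA′)V)(A′)|_{(−3)} for the functional V of (81); `dVAnalytic U₀ ε` = "(δ/δA′)V is an analytic function
  on {A′ : nMax A′ < ε}"; `Sol111 V U₀ A₁` = "A₁ solves Eq. (111) A₁ + 𝔊J + 𝔊((δ/δA′)V)(A₁ + H₁B) = 0";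
  `T112 V U₀ A₁` = exp iη[A₁ + H₁B − HD(A₁ + H₁B)] (112); `LikeH1B ε₁ U₀ 𝔄` = "𝔄 is 𝔤ᶜ-valued and satisfies
  the same bounds (103) as H₁B"; `Sol111G U₀ 𝔄 A₁` = "A₁ solves (111) with H₁B replaced by 𝔄";
  `SolAnalytic U₀ ε₁ ε₄` = "on {𝔄 : LikeH1B ε₁ 𝔄} the solution of (111) in the space (115) with parameter ε₄
  is an analytic function of 𝔄".
[cite: Balaban1985Variational, (14)–(21) pp.279–281] -/
structure LGData where
  Cfg : Type
  Bdry : Type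
  Pert : Type
  GT : Type
  Fld : Type
  Cell : Type
  Site : Type
  L : ℝ
  eta : ℝ
  dim : ℕ
  scale : Site → ℕ
  cscale : Cell → ℕ
  dist : Cell → Site → ℝ
  Sat14 : ℝ → ℝ → Bdry → Cfg → Prop
  In18 : ℝ → Bdry → Cfg → Pert → Prop
  Crit : Bdry → Cfg → Pert → Prop
  In19_21 : ℝ → Bdry → Cfg → Pert → Prop
  CritL : Bdry → Cfg → Pert → Prop
  Restricted : Cfg → GT → Prop
  toAxial : Cfg → Pert → GT → Pert
  In43 : Cfg → ℝ → Fld → Prop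
  nM1 : Cfg → Fld → ℝ
  Def47 : Cfg → ℝ → Prop
  T47 : Cfg → Fld → Fld
  normD : Cfg → Fld → ℝ
  kerD : Cfg → Fld → Cell → Site → ℝ
  nMax : Cfg → Fld → ℝ
  dVn : Cfg → Fld → ℝ
  dVAnalytic : Cfg → ℝ → Prop
  Sol111 : Bdry → Cfg → Fld → Prop
  T112 : Bdry → Cfg → Fld → Pert
  LikeH1B : ℝ → Cfg → Fld → Prop
  Sol111G : Cfg → Fld → Fld → Prop
  SolAnalytic : Cfg → ℝ → ℝ → Prop

/-- **Proposition 2** (p. 281 [5], verbatim): *"All critical orbits of the functional (5) in the space (6), or all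
critical configurations of this functional in the space (18), can be obtained by taking critical configurations U₁
of the functional A(U₁U₀) in the space defined by (19)–(21), where U₀ satisfies (14), and transforming them to the
axial gauge Ax_k(𝔅_k, U₀) by gauge transformations u satisfying the conditions \overline{R₀u}^j = 1 on Λ_j,
0, 1, …, k."*  Context (p. 280, verbatim): *"Configurations U from the space (18), and U₀, satisfy the assumptions
(1.33)–(1.35) of this theorem [Theorem 2 of [6]] with α₀ = ε₀, α₁ = C₁ε₁. … more exactly for ε₀ + C₁ε₁ ≤ c₁ …
with ε₂ ≥ B₁(ε₀ + C₁ε₁)."*  Typed in the "(18)" formulation; B₁, c₁ = the constants of [6] Thm 2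
(`B8.Thm2Printed`), B₃ = the constant (162), C₁ as in (14).  (GAPS G-B11-A4: with U₀ ∈ 𝔘_k(C₁B₃ε₁) the choice
α₀ = ε₀ needs C₁B₃ε₁ ≤ ε₀, not among the standing assumptions B₃ε₁ ≤ ε₀ ≤ a₀ of p. 279.)
[cite: Balaban1985Variational, Prop. 2 p.281] -/
def Prop2Printed (B₁ B₃ C₁ c₁ : ℝ) (fam : I → LGData) : Prop :=
  ∀ i : I, ∀ ε₀ ε₁ ε₂ : ℝ, 0 < ε₀ → 0 < ε₁ → ε₀ + C₁ * ε₁ ≤ c₁ → B₁ * (ε₀ + C₁ * ε₁) ≤ ε₂ →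
    ∀ V : (fam i).Bdry, ∀ U₀ : (fam i).Cfg, (fam i).Sat14 (C₁ * B₃ * ε₁) (C₁ * ε₁) V U₀ →
      ∀ U' : (fam i).Pert, (fam i).In18 ε₀ V U₀ U' → (fam i).Crit V U₀ U' →
        ∃ u : (fam i).GT, ∃ U₁ : (fam i).Pert, (fam i).Restricted U₀ u ∧
          (fam i).In19_21 ε₂ V U₀ U₁ ∧ (fam i).CritL V U₀ U₁ ∧ (fam i).toAxial U₀ U₁ u = U'

/-- **Proposition 3** (p. 289 [13], verbatim): *"The transformation (47) satisfying the identity (48), i.e.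
linearizing the averaging operation Q(ηA), is defined and analytic for A′ satisfying (43) with ε₃ sufficiently small
(e.g. 18C₂B₀dc₁(½)ε₃ ≤ 1, 2ε₃ ≤ c₄). The range of this transformation contains the set (43) with ε₂ ≤ ¼ε₃, and is
contained in the corresponding set with 2ε₃ instead of ε₂. The function D(A′) satisfies the bound (55) and its
functional derivative satisfies the bound (73)."*  With (47) A = A′ − HD(A′); (48) Q_j(ηA) = L^jηQ_jA′ on Λ_j;
(55) |D(A′)| ≤ 4C₂|A′|²_{(−1)}; (73) |𝔇(A′; c, b)| ≤ O(1)C₃ε₃(L^jη)^{−d+1}e^{−(1/2)δ₀d(c₋,y)}, b ∈ B^j(y), y ∈ Λ_j.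
Constants: C₂, c₄ of [4] Prop. 4 (complex form [4] Prop. 7, `B7.Prop4Printed`/`B7.Prop7Printed`), C₃ of [4] Prop. 5
(`B7.Prop5Printed`), B₀, δ₀ of [5] (norm and decay rate of H), c₁(½) the scale-sum constant of [3] Lemma 2.1 at rate
½δ₀ (`B6.Lemma21Printed`); "sufficiently small" typed as the printed "e.g." conditions; the background U₀ is the
one of (14) (p. 284).  (GAPS G-B11-C1: (44), (52), (54) use [4] Props 4, 5 for COMPLEX arguments — [4] Prop. 7 /
"formulations are obvious", upstream G-B7-05.) [cite: Balaban1985Variational, Prop. 3 p.289] -/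
def Prop3Printed (C₁ B₃ C₂ C₃ B₀ c1h c₄ δ₀ : ℝ) (fam : I → LGData) : Prop :=
  ∃ O₁ : ℝ, 0 < O₁ ∧ ∀ i : I, ∀ ε₁ ε₃ : ℝ, 0 < ε₁ → 0 < ε₃ →
    18 * C₂ * B₀ * (fam i).dim * c1h * ε₃ ≤ 1 → 2 * ε₃ ≤ c₄ →
    ∀ V : (fam i).Bdry, ∀ U₀ : (fam i).Cfg, (fam i).Sat14 (C₁ * B₃ * ε₁) (C₁ * ε₁) V U₀ →
      (fam i).Def47 U₀ ε₃ ∧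
      (∀ ε₂ : ℝ, ε₂ ≤ ε₃ / 4 → ∀ A : (fam i).Fld, (fam i).In43 U₀ ε₂ A →
        ∃ A' : (fam i).Fld, (fam i).In43 U₀ ε₃ A' ∧ (fam i).T47 U₀ A' = A) ∧
      (∀ A' : (fam i).Fld, (fam i).In43 U₀ ε₃ A' → (fam i).In43 U₀ (2 * ε₃) ((fam i).T47 U₀ A')) ∧
      (∀ A' : (fam i).Fld, (fam i).In43 U₀ ε₃ A' → (fam i).normD U₀ A' ≤ 4 * C₂ * (fam i).nM1 U₀ A' ^ 2) ∧
      (∀ A' : (fam i).Fld, ∀ c : (fam i).Cell, ∀ y : (fam i).Site, (fam i).In43 U₀ ε₃ A' →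
        (fam i).kerD U₀ A' c y ≤ O₁ * C₃ * ε₃ * ((fam i).L ^ (fam i).scale y * (fam i).eta) ^ (1 - ((fam i).dim : ℝ)) *
          Real.exp (-(δ₀ / 2) * (fam i).dist c y))

/-- **Proposition 4** (pp. 292–293 [16–17], verbatim): *"Let us consider the functional V(A′) on the space of
configurations A′ with values in the complexified Lie algebra gᶜ, and satisfying the inequalities (77), i.e.
max{|A′|_{(−1)}, |∇A′|_{(−2)}} < ε₃, for ε₃ ≤ a₃, where a₃ is a sufficiently small positive constant. The functional
derivative of V(A′) is an analytic function on this space, and satisfies the estimate |((δ/δA′)V)(A′)| <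
C₄ε₃²(L^jη)^{−3} on Ω_j, j = 0, 1, …, k. (97)  The constants a₃, C₄ depend on d and L only. The above estimate can
be formulated also in the following way: |((δ/δA′)V)(A′)|_{(−3)} ≤ C₄(max{|A′|_{(−1)}, |∇A′|_{(−2)}})², (98) and it
is valid if max{|A′|_{(−1)}, |∇A′|_{(−2)}} ≤ a₃."*  V = the terms of order ≥ 3 of the expansion (81) around the
background U₀ of (14) (J enters through (86) with |J| < C₁B₃ε₁(L^jη)^{−3} (28)); the proof uses (1.50), (1.52) of
[6] for the commutator term (93)–(96).  The standing smallness of ε₁ is displayed as the threshold `c`.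
[cite: Balaban1985Variational, Prop. 4 (97)–(98) pp.292–293] -/
def Prop4Printed (C₁ B₃ : ℝ) (fam : I → LGData) : Prop :=
  ∃ a₃ C₄ c : ℝ, 0 < a₃ ∧ 0 < C₄ ∧ 0 < c ∧ ∀ i : I, ∀ ε₁ : ℝ, 0 < ε₁ → ε₁ ≤ c →
    ∀ V : (fam i).Bdry, ∀ U₀ : (fam i).Cfg, (fam i).Sat14 (C₁ * B₃ * ε₁) (C₁ * ε₁) V U₀ →
      (∀ ε₃ : ℝ, 0 < ε₃ → ε₃ ≤ a₃ → (fam i).dVAnalytic U₀ ε₃ ∧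
        ∀ A' : (fam i).Fld, (fam i).nMax U₀ A' < ε₃ → (fam i).dVn U₀ A' < C₄ * ε₃ ^ 2) ∧
      (∀ A' : (fam i).Fld, (fam i).nMax U₀ A' ≤ a₃ → (fam i).dVn U₀ A' ≤ C₄ * (fam i).nMax U₀ A' ^ 2)

/-- **Proposition 5** (p. 294 [18], verbatim): *"All critical configurations U₁ of the functional A(U₁U₀) in the
space defined by (19)–(21), U₀ satisfies (14), can be obtained from solutions of Eq. (111) in the space (104) by the
transformation U₁ = exp iη[A₁ + H₁B − HD(A₁ + H₁B)]. (112)"*  With (104): |A₁| < 2ε₃(L^jη)^{−1}, |∇A₁| <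
2ε₃(L^jη)^{−2}; (111): A₁ + 𝔊J + 𝔊((δ/δA′)V)(A₁ + H₁B) = 0, 𝔊 = G₁𝔓* "proved in [5]" to be the operator (3.148)
with Q𝔊 = 0, RD*𝔊 = 0; the constants restricted by (113): B₃ε₁ ≤ ε₀, B₁(ε₀ + C₁ε₁) ≤ ε₂, ε₂ ≤ ¼ε₃, "ε₃
sufficiently small" (displayed as the threshold `c`).  Edge to [5] (GAPS C-B11-D1R): by (79) p. 290, *"½⟨A′, Δ_πA′⟩
− ⟨HC⁽²⁾(A′), J⟩ = ½⟨A′, Δ_πA′⟩ − ½⟨A′, Δ_π⁽²⁾A′⟩ = ½⟨A′, Δ₁A′⟩"*, so Δ₁ = Δ_π − Δ_π⁽²⁾ is the quadratic form of [5]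
(3.127)–(3.128), (3.134)–(3.135), and H₁, G₁ = (Δ₁ + DRD* + aQ*Q)⁻¹, 𝔓, 𝔊 = G₁𝔓* are [5]'s Sect. D operators
(3.129), (3.128)/(3.138), (3.147), (3.148)–(3.153), for which Thms 3.12–3.13 (`B9.Thm312_313Printed`) are stated;
the residual hypothesis of the edge is that U₀ satisfies (3.35)–(3.36) of [5] ((14) and [6] Prop. 6, GAPS C-B11-A3).
[cite: Balaban1985Variational, Prop. 5 (111)–(112) p.294] -/
def Prop5Printed (B₁ B₃ C₁ : ℝ) (fam : I → LGData) : Prop :=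
  ∃ c : ℝ, 0 < c ∧ ∀ i : I, ∀ ε₀ ε₁ ε₂ ε₃ : ℝ, 0 < ε₁ → B₃ * ε₁ ≤ ε₀ → B₁ * (ε₀ + C₁ * ε₁) ≤ ε₂ →
    ε₂ ≤ ε₃ / 4 → ε₃ ≤ c →
    ∀ V : (fam i).Bdry, ∀ U₀ : (fam i).Cfg, (fam i).Sat14 (C₁ * B₃ * ε₁) (C₁ * ε₁) V U₀ →
      ∀ U₁ : (fam i).Pert, (fam i).In19_21 ε₂ V U₀ U₁ → (fam i).CritL V U₀ U₁ →
        ∃ A₁ : (fam i).Fld, (fam i).nMax U₀ A₁ < 2 * ε₃ ∧ (fam i).Sol111 V U₀ A₁ ∧ (fam i).T112 V U₀ A₁ = U₁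

/-- **Proposition 6** (pp. 295–296 [19–20], verbatim): *"There exists a positive, absolute constant a₄ such, that
for ε₄ ≤ a₄ and ε₁ satisfying 2B₀C₁B₃ε₁ ≤ ε₄ Eq. (111) has exactly one solution in the space (115). This solution
satisfies the bounds (115) with ε₄ = 3B₀C₁B₃ε₁. Moreover, if we replace the configuration H₁B by an arbitrary
configuration 𝔄 with values in the complexified Lie algebra, and satisfying the same bounds as H₁B, then the above
statement is again true and the solution is an analytic function of 𝔄."*  With (115): max{|A₁|_{(−1)}, |∇A₁|_{(−2)}}
< ε₄; B₀ = the norm of 𝔊 from [5] Thm 3.13 ((117)).  "Absolute" = depending on d, L only (through B₀, C₄, a₃, B₃,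
C₁ = L³; DIVERGENCE D-B11-3); the sufficient conditions (118), (121) hold e.g. with a₄ = min{a₃/4, (16B₀C₄)⁻¹} when
B₃ ≥ dL, see `ineq118_121`.  [cite: Balaban1985Variational, Prop. 6 p.295] -/
def Prop6Printed (B₀ B₃ C₁ : ℝ) (fam : I → LGData) : Prop :=
  ∃ a₄ : ℝ, 0 < a₄ ∧ ∀ i : I, ∀ ε₁ ε₄ : ℝ, 0 < ε₁ → ε₄ ≤ a₄ → 2 * B₀ * C₁ * B₃ * ε₁ ≤ ε₄ →
    ∀ V : (fam i).Bdry, ∀ U₀ : (fam i).Cfg, (fam i).Sat14 (C₁ * B₃ * ε₁) (C₁ * ε₁) V U₀ →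
      (∃ A₁ : (fam i).Fld, (fam i).nMax U₀ A₁ < ε₄ ∧ (fam i).Sol111 V U₀ A₁ ∧
        (fam i).nMax U₀ A₁ < 3 * B₀ * C₁ * B₃ * ε₁ ∧
        ∀ A₁' : (fam i).Fld, (fam i).nMax U₀ A₁' < ε₄ → (fam i).Sol111 V U₀ A₁' → A₁' = A₁) ∧
      (∀ 𝔄 : (fam i).Fld, (fam i).LikeH1B ε₁ U₀ 𝔄 →
        ∃ A₁ : (fam i).Fld, (fam i).nMax U₀ A₁ < ε₄ ∧ (fam i).Sol111G U₀ 𝔄 A₁ ∧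
          ∀ A₁' : (fam i).Fld, (fam i).nMax U₀ A₁' < ε₄ → (fam i).Sol111G U₀ 𝔄 A₁' → A₁' = A₁) ∧
      (fam i).SolAnalytic U₀ ε₁ ε₄

/-! ### Variational-problem carrier extended by the notions Props 7, 8 and Sect. F speak about -/

/-- The carrier `VarProblem` of Theorem 1 extended by the two notions Propositions 7, 8 and Sect. F are stated in:
`IsCritical V U` = "U is a critical configuration of the functional (5)" (on the constraint manifold
𝔅_k(𝔅_k, V) (3)), `SameOrbit U U′` = "U, U′ lie on one orbit of the group (4) of gauge transformations".
[cite: Balaban1985Variational, (4)–(6) p.278] -/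
structure VarProblemX extends VarProblem where
  IsCritical : Bdry → Cfg → Prop
  SameOrbit : Cfg → Cfg → Prop

/-- The dictionary between the primitive fields of `VarProblem` (`OnMinimalOrbit`, `UniqueCriticalOrbit`, due to the
Thm 1 typing) and the notions of `VarProblemX`, as used on pp. 299–305 — hypotheses of the bookkeeping below, never
asserted: (i) 𝔘_k(e) ⊂ 𝔘_k(e′) for e ≤ e′ ((2) are strict upper bounds); (ii) a configuration on a minimal orbit of
(5) in 𝔘_k(e) ∩ 𝔅_k(V) is critical and lies in that space; (iii) a configuration on a minimal orbit in
𝔘_k(e′) ∩ 𝔅_k(V) which lies in 𝔘_k(e) is on a minimal orbit in 𝔘_k(e) ∩ 𝔅_k(V) — valid for all e, e′ in the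
LOCAL-minimum reading the proof establishes (p. 299 "A second order differential at A′ = 0 … is positive definite.
Hence A′ = 0 is a minimum", p. 301 "a sufficiently small neighborhood"; DIVERGENCE D-B11-2), and for e ≤ e′ in
the global reading; (iv) "the orbit of U is the unique critical orbit in (6)" ⇐ U is critical, lies in (6), and every
critical configuration in (6) lies on the orbit of U. [cite: Balaban1985Variational, pp.299–305] -/
def VarProblemX.Laws (P : VarProblemX) : Prop :=
  (∀ (e e' : ℝ) (U : P.Cfg), e ≤ e' → P.InU e U → P.InU e' U) ∧
  (∀ (e : ℝ) (V : P.Bdry) (U : P.Cfg), P.OnMinimalOrbit e V U → P.IsCritical V U ∧ P.InU e U ∧ P.InB V U) ∧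
  (∀ (e e' : ℝ) (V : P.Bdry) (U : P.Cfg), P.OnMinimalOrbit e' V U → P.InU e U → P.OnMinimalOrbit e V U) ∧
  (∀ (ε₀ : ℝ) (V : P.Bdry) (U : P.Cfg), P.InU ε₀ U → P.InB V U → P.IsCritical V U →
    (∀ U' : P.Cfg, P.InU ε₀ U' → P.InB V U' → P.IsCritical V U' → P.SameOrbit U' U) →
      P.UniqueCriticalOrbit ε₀ V U)

/-- "the variational problem (5), (6) has at most one critical orbit" (Prop. 7): any two critical configurations of
(5) in 𝔘_k(ε₀) ∩ 𝔅_k(V) lie on one orbit. [cite: Balaban1985Variational, Prop. 7 p.299] -/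
def VarProblemX.AtMostOneCriticalOrbit (P : VarProblemX) (ε₀ : ℝ) (V : P.Bdry) : Prop :=
  ∀ U U' : P.Cfg, P.InU ε₀ U → P.InB V U → P.IsCritical V U →
    P.InU ε₀ U' → P.InB V U' → P.IsCritical V U' → P.SameOrbit U U'

/-- **Proposition 7** (p. 299 [23], verbatim): *"There exist positive, absolute constants a₀, a′₁ such that for
ε₀ ≤ a₀ and B₃ε₁ ≤ ε₀ the variational problem (5), (6) has at most one critical orbit. If ε₁ ≤ a′₁, then there
exists a minimal orbit in the space (6) with ε₀ = O(1)C₁B₃ε₁."*  Followed by (verbatim): *"This proposition implies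
Theorem 1 but with worse bounds on the minimal configuration, and without the regularity results (9), (10). These
regularity results and the improved bounds will be proved in the next section."*  (V satisfies (7) with ε₁ — the
standing hypothesis of p. 278; a₀ = a₄/(16B₁C₁) by (122); "absolute" = (d, L)-dependent, DIVERGENCE D-B11-3; the
minimality step uses the positive-definiteness of ½⟨A′, Δ₁A′⟩ on {QA′ = 0, RD*A′ = 0} = [5] Thm 3.11 extended to G₁ by
Thm 3.12 (`B9.Thm311Printed`, `B9.Thm312_313Printed`) and yields a LOCAL minimum, GAPS G-B11-E5/E5R.)
[cite: Balaban1985Variational, Prop. 7 p.299] -/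
def Prop7Printed (B₃ C₁ : ℝ) (fam : I → VarProblemX) : Prop :=
  ∃ a₀ a₁' O₁ : ℝ, 0 < a₀ ∧ 0 < a₁' ∧ 0 < O₁ ∧
    ∀ i : I, ∀ ε₀ ε₁ : ℝ, 0 < ε₁ → ∀ V : (fam i).Bdry, (fam i).Reg7 ε₁ V →
      (ε₀ ≤ a₀ → B₃ * ε₁ ≤ ε₀ → (fam i).AtMostOneCriticalOrbit ε₀ V) ∧
      (ε₁ ≤ a₁' → ∃ U : (fam i).Cfg, (fam i).OnMinimalOrbit (O₁ * C₁ * B₃ * ε₁) V U)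

/-- **Proposition 8** (p. 304 [28], verbatim): *"There exists a positive, absolute constant a₅ such, that if U is a
critical configuration of (5) in the space (6) with V satisfying (7), and if ε₀ ≤ a₅, then U belongs to the space
(8)."*  ((8) = 𝔘_k({Ω_j}, B₃ε₁) ∩ 𝔅_k(𝔅_k, V); a₅ fixed by (166) B₀(C₄ + 4C₂)(36dL²B₁R₁M₁)²a₅ ≤ ⅛ and "all the
previous restrictions on ε₀"; proof = Sect. F pp. 300–304 with M = R₁M₁ and the halving iteration
ε₀ ↦ max{B₃ε₁, ½ε₀}, see `halving_reaches_B3eps1`.) [cite: Balaban1985Variational, Prop. 8 p.304] -/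
def Prop8Printed (B₃ : ℝ) (fam : I → VarProblemX) : Prop :=
  ∃ a₅ : ℝ, 0 < a₅ ∧ ∀ i : I, ∀ ε₀ ε₁ : ℝ, 0 < ε₁ → ∀ V : (fam i).Bdry, ∀ U : (fam i).Cfg,
    (fam i).Reg7 ε₁ V → (fam i).InU ε₀ U → (fam i).InB V U → (fam i).IsCritical V U → ε₀ ≤ a₅ →
      (fam i).InU (B₃ * ε₁) U

/-- The conclusion of **Sect. F** for the regularity (9), (10) (p. 300 [24], verbatim: *"In this section we will
prove all the regularity properties of minimal configurations U_k. We will use only the fact that they are critical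
configurations of the functional (5) and that they belong to the spaces (6) with ε₀ sufficiently small."*; p. 305
[29], verbatim: *"Assuming M′B₃ε₁ ≤ a₅, we get from the inequality (167), (the left-hand side of (167)) <
¼MB₃ε₁ + ⅛M′B₃ε₁ < ½MB₃ε₁. (169)  The condition M′ε₁ ≤ a₁ implies M′B₃ε₁ ≤ a₅, hence we have proved the regularity
conditions (9), (10), and the proof of Theorem 1 is completed."*), for cubes of size 2ML^jη, M = M′R₁M₁ ≤
R₁M₁(a₁/ε₁) = M(ε₁).  GAPS G-B11-F3: the printed derivation ((152), (164)–(169)) bounds |A|, |∇^ηA|,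
|∂^{η*}∂^ηA|, |Δ^ηA| only — the Hölder clause ‖A‖_{1,β} < B₄(β₀)Mε₁(L^jη)^{−2−β}, 0 ≤ β ≤ β₀ = 1, of (9) is not
derived and B₄ is never defined in the paper (the only available source, (1.36) of [6] Thm 2, is stated for
β ≤ β₀ < 1).  [cite: Balaban1985Variational, Sect. F (169) pp.300–305] -/
def SectFPrinted (B₃ : ℝ) (fam : I → VarProblemX) : Prop :=
  ∃ a₁ B₄ RM : ℝ, 0 < a₁ ∧ 0 < B₄ ∧ 0 < RM ∧
    ∀ i : I, ∀ ε₁ : ℝ, ∀ V : (fam i).Bdry, ∀ U : (fam i).Cfg, 0 < ε₁ → ε₁ ≤ a₁ → (fam i).Reg7 ε₁ V →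
      (fam i).InU (B₃ * ε₁) U → (fam i).InB V U → (fam i).IsCritical V U →
        ∀ c : (fam i).Cube, (fam i).sizeM c ≤ RM * (a₁ / ε₁) → Regularity (fam i).toVarProblem B₃ B₄ ε₁ U c

/-! ### Sect. G carrier and Proposition 9 -/

/-- The five scale prefactors of (190): (L^jη)^{−1}, (L^jη)^{−2}, (L^jη)^{−2−β}, (L^jη)^{−3}, (L^jη)^{−3}.
[cite: Balaban1985Variational, (190) p.308] -/
noncomputable def pref190 (t β : ℝ) : Fin 5 → ℝ :=
  ![t ^ (-(1 : ℝ)), t ^ (-(2 : ℝ)), t ^ (-(2 + β)), t ^ (-(3 : ℝ)), t ^ (-(3 : ℝ))]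

/-- Abstract carrier of Sect. G (pp. 305–309 [29–33]) for fixed (d, L) and geometric datum: `Bdry` = G-valued V₀ on
𝔅_k; `CB` = 𝔤ᶜ-valued configurations B on 𝔅_k (B = (1/i) log V′) with sup norm `bnorm`; `Site`, `scale`, `sdist`
= points y ∈ Λ_j, j(y), d(y, y′); `Reg7 ε₁ V₀` = (7); `ExtAnalytic r V₀` = "the minimal configuration U_k(V′V₀)
in the axial gauge has an extension to an analytic function of Gᶜ-valued configurations V′ on 𝔅_k with
|V′ − 1| < r"; `ExtOrbits r V₀` = "it extends further to all orbits of such configurations V′V₀ by the equality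
(181) U_k(V^v) = U_k(V)^{v̄}"; `HDet V₀ B` = "U_k(V′V₀)U_k(V₀)⁻¹ transformed to the Landau gauge equals exp iη𝓗(B),
𝓗(B) determined by (174), (175), or (179), (180)"; `HAnalytic r V₀` = "𝓗 is an analytic function of B on
{|B| < r}, and also of the external gauge field configuration U satisfying (3.35)–(3.38) [5], or (1.7)–(1.9) [6]";
`HIn19_21 ε₂ V₀ B` = "𝓗(B) satisfies (19)–(21) with ε₂"; `dH n β V₀ B y y′` (n = 0, …, 4) = the five left-hand
sides of (190) localised at x ∈ Δ(y) (resp. supp ζ ⊂ Δ̃(y), Hölder index β, normalised by ‖ζ‖^#_β + |ζ|) and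
y′: |(δ/δB_ν(y′))𝓗_μ(B, x)|, |∇_x(δ/δB_ν(y′))𝓗_μ(B, x)|, ‖ζ∇(δ/δB(y′))𝓗(B)‖_β, |D^{η*}_{U_k}D^η_{U_k}(δ/δB_ν(y′))
𝓗_μ(B, x)|, |Δ^η_{U_k}(δ/δB_ν(y′))𝓗_μ(B, x)|. [cite: Balaban1985Variational, (170)–(190) pp.305–308] -/
structure AnData where
  Bdry : Type
  CB : Type
  Site : Type
  L : ℝ
  eta : ℝ
  dim : ℕ
  scale : Site → ℕ
  sdist : Site → Site → ℝ
  Reg7 : ℝ → Bdry → Prop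
  bnorm : CB → ℝ
  ExtAnalytic : ℝ → Bdry → Prop
  ExtOrbits : ℝ → Bdry → Prop
  HDet : Bdry → CB → Prop
  HAnalytic : ℝ → Bdry → Prop
  HIn19_21 : ℝ → Bdry → CB → Prop
  dH : Fin 5 → ℝ → Bdry → CB → Site → Site → ℝ

/-- **Proposition 9** (p. 309 [33], verbatim): *"The minimal configuration U_k(V) = U_k(V′V₀) in the axial gauge
has an extension to an analytic function of Gᶜ-valued small configurations V′ on 𝔅_k. It can be extended further to
all orbits of such configurations V′V₀ by the equality (181). The function U_k(V′V₀)U_k(V₀)⁻¹ transformed to the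
Landau gauge is, by the definition, equal to exp iη𝓗(B), where B = (1/i) log V′. The function 𝓗(B) is determined
by Eqs. (174), (175), or (179), (180). It is an analytic function of B, and also of the external gauge field
configuration U satisfying the regularity conditions (3.35)–(3.38) [5], or (1.7)–(1.9) [6]. It satisfies the
conditions (19)–(21) with ε₂ = B₅ε₁ (see (173)), and its functional derivative (182) satisfies the inequalities
(190)."*  With (172): |V′ − 1| < C₁ε₁, |B| < 2C₁ε₁ "for ε₁ sufficiently small" (threshold `c`); (173): B₅ = 6B₁B₃C₁;
(190): the five quantities ≤ O(1)·[(L^jη)^{−1}, (L^jη)^{−2}, (‖ζ‖^#_β + |ζ|)(L^jη)^{−2−β}, (L^jη)^{−3}, (L^jη)^{−3}]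
·(L^{j′}η)^{−d} exp(−⅛δ₀d(y, y′)), y ∈ Λ_j, y′ ∈ Λ_{j′} (β-range not printed at (190); typed 0 ≤ β ≤ β₀ with β₀ a
parameter, DIVERGENCE D-B11-1).  GAPS G-B11-G2 (load-bearing for B12's inductive hypothesis on U_k(V)): (190)
rests on the kernel bound (189) whose proof is omitted in print (p. 308, verbatim: *"We do not perform these
calculations here, we have obtained all necessary results to do the calculations and estimates, let us formulate a
final result only"*); G-B11-G1/G3: "the new operator G has exactly the same properties as Δ_a⁻¹" (p. 306) and "All
the above considerations and properties are valid for this function also" (p. 309) are by-analogy steps.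
[cite: Balaban1985Variational, Prop. 9 (190) p.309] -/
def Prop9Printed (B₅ C₁ β₀ δ₀ : ℝ) (fam : I → AnData) : Prop :=
  ∃ O₁ c : ℝ, 0 < O₁ ∧ 0 < c ∧ ∀ i : I, ∀ ε₁ : ℝ, 0 < ε₁ → ε₁ ≤ c →
    ∀ V₀ : (fam i).Bdry, (fam i).Reg7 ε₁ V₀ →
      (fam i).ExtAnalytic (C₁ * ε₁) V₀ ∧ (fam i).ExtOrbits (C₁ * ε₁) V₀ ∧ (fam i).HAnalytic (2 * C₁ * ε₁) V₀ ∧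
      ∀ B : (fam i).CB, (fam i).bnorm B < 2 * C₁ * ε₁ →
        (fam i).HDet V₀ B ∧ (fam i).HIn19_21 (B₅ * ε₁) V₀ B ∧
        ∀ n : Fin 5, ∀ β : ℝ, 0 ≤ β → β ≤ β₀ → ∀ y y' : (fam i).Site,
          (fam i).dH n β V₀ B y y' ≤
            O₁ * pref190 ((fam i).L ^ (fam i).scale y * (fam i).eta) β n *
              ((fam i).L ^ (fam i).scale y' * (fam i).eta) ^ (-((fam i).dim : ℝ)) *
              Real.exp (-(δ₀ / 8) * (fam i).sdist y y')

/-! ### Paper-internal bookkeeping (kernel-checked) -/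

/-- **Theorem 1 ⇐ Proposition 7 + Proposition 8 + Sect. F** — the architecture stated on p. 281 ("This will
prove Theorem 1 with worse bounds. Next we will improve the bounds and we will complete the proof of this theorem"),
p. 299 and pp. 304–305 ("Now we define a₁ as a largest constant such, that the restriction ε₁ ≤ a₁ implies all the
other restrictions we have imposed on ε₁"), assembled over r2's carrier: with the dictionary `Laws`, Thm 1 as printed
(`Thm1Printed`, incl. B₃a₁ ≤ a₀ and M(ε₁) = R₁M₁(a₁/ε₁)) follows by pure logic, a₁ := min{a′₁, a₁(F), a₅/(O(1)C₁B₃),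
a₀/B₃}.  [folklore] -/
theorem thm1_of_prop7_prop8_sectF (fam : I → VarProblemX) (B₃ C₁ : ℝ) (hB₃ : 0 < B₃) (hC₁ : 0 < C₁)
    (laws : ∀ i, (fam i).Laws) (h7 : Prop7Printed B₃ C₁ fam) (h8 : Prop8Printed B₃ fam)
    (hF : SectFPrinted B₃ fam) : Thm1Printed (fun i => (fam i).toVarProblem) := by
  obtain ⟨a₀, a₁', O₁, ha₀, ha₁', hO₁, H7⟩ := h7
  obtain ⟨a₅, ha₅, H8⟩ := h8
  obtain ⟨aF, B₄, RM, haF, hB₄, hRM, HF⟩ := hF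
  have hK : 0 < O₁ * C₁ * B₃ := by positivity
  -- the final a₁ of p. 304
  set a₁ : ℝ := min (min a₁' aF) (min (a₅ / (O₁ * C₁ * B₃)) (a₀ / B₃)) with ha₁def
  have ha₁pos : 0 < a₁ := by
    simp only [ha₁def, lt_min_iff]
    exact ⟨⟨ha₁', haF⟩, div_pos ha₅ hK, div_pos ha₀ hB₃⟩
  have h1 : a₁ ≤ a₁' := le_trans (min_le_left _ _) (min_le_left _ _)
  have h2 : a₁ ≤ aF := le_trans (min_le_left _ _) (min_le_right _ _)
  have h3 : a₁ ≤ a₅ / (O₁ * C₁ * B₃) := le_trans (min_le_right _ _) (min_le_left _ _)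
  have h4 : a₁ ≤ a₀ / B₃ := le_trans (min_le_right _ _) (min_le_right _ _)
  refine ⟨a₀, a₁, B₃, B₄, fun e => RM * (a₁ / e), ha₀, ha₁pos, hB₃, hB₄, ?_, ?_, ?_⟩
  · have := (le_div_iff₀ hB₃).1 h4
    linarith [mul_comm B₃ a₁]
  · intro e he
    positivity
  intro i ε₁ hε₁ hε₁a V hV
  obtain ⟨Lmono, Lmin, Lrestr, Luniq⟩ := laws i
  -- existence on p. 304: Prop 7 gives a minimal orbit with ε₀ = O(1)C₁B₃ε₁, Prop 8 puts it into (8)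
  have hex : ∃ U : (fam i).Cfg, (fam i).InU (B₃ * ε₁) U ∧ (fam i).InB V U ∧
      (fam i).OnMinimalOrbit (B₃ * ε₁) V U := by
    obtain ⟨U, hU⟩ := (H7 i a₀ ε₁ hε₁ V hV).2 (le_trans hε₁a h1)
    obtain ⟨hc, hIn, hB⟩ := Lmin _ V U hU
    have hε₀a₅ : O₁ * C₁ * B₃ * ε₁ ≤ a₅ := by
      have := (le_div_iff₀ hK).1 h3
      nlinarith
    have h8U := H8 i (O₁ * C₁ * B₃ * ε₁) ε₁ hε₁ V U hV hIn hB hc hε₀a₅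
    exact ⟨U, h8U, hB, Lrestr _ _ V U hU h8U⟩
  refine ⟨hex, ?_, ?_⟩
  · intro ε₀ hlo hhi U hU
    obtain ⟨hc, hIn, hB⟩ := Lmin _ V U hU
    have hIn0 : (fam i).InU ε₀ U := Lmono _ _ U hlo hIn
    have hAM := (H7 i ε₀ ε₁ hε₁ V hV).1 hhi hlo
    exact Luniq ε₀ V U hIn0 hB hc (fun U' h1' h2' h3' => hAM U' U h1' h2' h3' hIn0 hB hc)
  · intro U hU c hc
    obtain ⟨hcrit, hIn, hB⟩ := Lmin _ V U hU
    have hcF : (fam i).sizeM c ≤ RM * (aF / ε₁) := by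
      refine le_trans hc ?_
      have : a₁ / ε₁ ≤ aF / ε₁ := div_le_div_of_nonneg_right h2 hε₁.le
      nlinarith
    exact HF i ε₁ V U hε₁ (le_trans hε₁a h2) hV hIn hB hcrit c hcF

/-- **Uniqueness in the Landau gauge ⇐ Props 2, 5, 6** (p. 296 [20], verbatim: *"If we take ε₄ = 8ε₂, and if we
assume 8ε₂ ≤ a₄ and 2B₀C₁B₃ε₁ ≤ 8ε₂, then by Propositions 5 and 6 there is at most one critical configuration of (5)
in (19)–(21). We get the same conclusion for the second problem if we take ε₂ = B₁(ε₀ + C₁ε₁) and assume the above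
restrictions."*): any two critical configurations in the axial-gauge space (18) are restricted-gauge transforms of ONE
Landau-gauge configuration U₁ (ε₃ = 4ε₂, so that the space (104) is the space (115) with ε₄ = 8ε₂). [folklore] -/
theorem axial_critical_from_one_landau (B₀ B₁ B₃ C₁ c₁ : ℝ) (fam : I → LGData)
    (h2 : Prop2Printed B₁ B₃ C₁ c₁ fam) (h5 : Prop5Printed B₁ B₃ C₁ fam) (h6 : Prop6Printed B₀ B₃ C₁ fam) :
    ∃ c a₄ : ℝ, 0 < c ∧ 0 < a₄ ∧ ∀ i : I, ∀ ε₀ ε₁ ε₂ : ℝ, 0 < ε₀ → 0 < ε₁ → ε₀ + C₁ * ε₁ ≤ c₁ →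
      B₃ * ε₁ ≤ ε₀ → ε₂ = B₁ * (ε₀ + C₁ * ε₁) → 8 * ε₂ ≤ a₄ → 2 * B₀ * C₁ * B₃ * ε₁ ≤ 8 * ε₂ → 4 * ε₂ ≤ c →
      ∀ V : (fam i).Bdry, ∀ U₀ : (fam i).Cfg, (fam i).Sat14 (C₁ * B₃ * ε₁) (C₁ * ε₁) V U₀ →
        ∀ U' U'' : (fam i).Pert, (fam i).In18 ε₀ V U₀ U' → (fam i).Crit V U₀ U' →
          (fam i).In18 ε₀ V U₀ U'' → (fam i).Crit V U₀ U'' →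
            ∃ U₁ : (fam i).Pert, ∃ u u' : (fam i).GT, (fam i).Restricted U₀ u ∧ (fam i).Restricted U₀ u' ∧
              (fam i).toAxial U₀ U₁ u = U' ∧ (fam i).toAxial U₀ U₁ u' = U'' := by
  obtain ⟨c, hc, H5⟩ := h5
  obtain ⟨a₄, ha₄, H6⟩ := h6
  refine ⟨c, a₄, hc, ha₄, ?_⟩
  intro i ε₀ ε₁ ε₂ hε₀ hε₁ hsum hB₃ hε₂ h8 h2B h4c V U₀ h14 U' U'' hU' hcU' hU'' hcU''
  obtain ⟨u, U₁, hu, h19, hcrit, hax⟩ := h2 i ε₀ ε₁ ε₂ hε₀ hε₁ hsum (le_of_eq hε₂.symm) V U₀ h14 U' hU' hcU'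
  obtain ⟨u', U₁', hu', h19', hcrit', hax'⟩ := h2 i ε₀ ε₁ ε₂ hε₀ hε₁ hsum (le_of_eq hε₂.symm) V U₀ h14 U'' hU'' hcU''
  have hq : ε₂ ≤ 4 * ε₂ / 4 := by linarith
  obtain ⟨A₁, hA₁, hsol, hT⟩ := H5 i ε₀ ε₁ ε₂ (4 * ε₂) hε₁ hB₃ (le_of_eq hε₂.symm) hq h4c V U₀ h14 U₁ h19 hcrit
  obtain ⟨A₁', hA₁', hsol', hT'⟩ := H5 i ε₀ ε₁ ε₂ (4 * ε₂) hε₁ hB₃ (le_of_eq hε₂.symm) hq h4c V U₀ h14 U₁' h19' hcrit'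
  obtain ⟨⟨A, _, _, _, huniq⟩, _, _⟩ := H6 i ε₁ (8 * ε₂) hε₁ h8 h2B V U₀ h14
  have e1 : A₁ = A := huniq A₁ (by linarith) hsol
  have e2 : A₁' = A := huniq A₁' (by linarith) hsol'
  have hU : U₁' = U₁ := by rw [← hT, ← hT', e1, e2]
  exact ⟨U₁, u, u', hu, hu', hax, hU ▸ hax'⟩

/-- **(122)** p. 296 [20]: with ε₂ = B₁ε₀ + B₁C₁B₃ε₁ ("we have B₁ = 5dLB₀") and B₃ε₁ ≤ ε₀, C₁ ≥ 1:
8ε₂ ≤ 8B₁ε₀ + 8B₁C₁ε₀ ≤ 16B₁C₁ε₀ — hence a₀ = a₄/(16B₁C₁) in Prop. 7. [cite: Balaban1985Variational, (122) p.296] -/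
theorem ineq122 (B₁ B₃ C₁ ε₀ ε₁ : ℝ) (hB₁ : 0 ≤ B₁) (hC₁ : 1 ≤ C₁) (hε₀ : 0 ≤ ε₀) (h : B₃ * ε₁ ≤ ε₀) :
    8 * (B₁ * ε₀ + B₁ * C₁ * B₃ * ε₁) ≤ 16 * B₁ * C₁ * ε₀ := by
  have h1 : B₁ * C₁ * (B₃ * ε₁) ≤ B₁ * C₁ * ε₀ := mul_le_mul_of_nonneg_left h (by positivity)
  have h2 : B₁ * ε₀ * 1 ≤ B₁ * ε₀ * C₁ := mul_le_mul_of_nonneg_left hC₁ (by positivity)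
  nlinarith

/-- **(173)** p. 305 [29]: ε₂ = B₁(B₃(1 + 4C₁)ε₁ + C₁ε₁) ≤ 6B₁B₃C₁ε₁ = B₅ε₁ for B₃, C₁ ≥ 1 (α₀ = B₃(1 + 4C₁)ε₁
because V′V₀ satisfies (7) with (1 + 4C₁)ε₁, α₁ = C₁ε₁ by (172)). [cite: Balaban1985Variational, (173) p.305] -/
theorem ineq173 (B₁ B₃ C₁ ε₁ : ℝ) (hB₁ : 0 ≤ B₁) (hB₃ : 1 ≤ B₃) (hC₁ : 1 ≤ C₁) (hε₁ : 0 ≤ ε₁) :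
    B₁ * (B₃ * (1 + 4 * C₁) * ε₁ + C₁ * ε₁) ≤ 6 * B₁ * B₃ * C₁ * ε₁ := by
  have h1 : B₃ * 1 ≤ B₃ * C₁ := mul_le_mul_of_nonneg_left hC₁ (by linarith)
  have h2 : 1 * C₁ ≤ B₃ * C₁ := mul_le_mul_of_nonneg_right hB₃ (by linarith)
  have h3 : B₃ * (1 + 4 * C₁) + C₁ ≤ 6 * B₃ * C₁ := by nlinarith
  have h4 : 0 ≤ B₁ * ε₁ := by positivity
  nlinarith [mul_le_mul_of_nonneg_left h3 h4]

/-- p. 296 [20], existence bound: ε₄ = 2(2B₀C₁B₃ε₁ + 2dLB₀C₁ε₁) ≤ 5dLB₀C₁B₃ε₁ = B₁C₁B₃ε₁ (B₁ = 5dLB₀), valid for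
dL ≥ 4 and B₃ ≥ 1. [cite: Balaban1985Variational, p.296] -/
theorem eps4_existence_bound (dL B₀ C₁ B₃ ε₁ : ℝ) (hdL : 4 ≤ dL) (hB₃ : 1 ≤ B₃) (hB₀ : 0 ≤ B₀) (hC₁ : 0 ≤ C₁)
    (hε₁ : 0 ≤ ε₁) : 2 * (2 * B₀ * C₁ * B₃ * ε₁ + 2 * dL * B₀ * C₁ * ε₁) ≤ 5 * dL * B₀ * C₁ * B₃ * ε₁ := by
  have h1 : 4 * B₃ ≤ dL * B₃ := mul_le_mul_of_nonneg_right hdL (by linarith)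
  have h2 : dL * 1 ≤ dL * B₃ := mul_le_mul_of_nonneg_left hB₃ (by linarith)
  have h3 : 4 * (B₃ + dL) ≤ 5 * dL * B₃ := by nlinarith
  have h4 : 0 ≤ B₀ * C₁ * ε₁ := by positivity
  nlinarith [mul_le_mul_of_nonneg_left h3 h4]

/-- **(118) and (121)** p. 295 [19] ("These conditions are satisfied if e.g. 2B₀C₁B₃ε₁ ≤ ε₄ and ε₄ ≤ a₄ for a
sufficiently small a₄"): an explicit admissible choice is a₄ = min{a₃/4, (16B₀C₄)⁻¹}, provided B₃ ≥ dL (true for the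
B₃ of (162), which is ≥ 72d³L³B₀). [cite: Balaban1985Variational, (118)–(121) p.295] -/
theorem ineq118_121 (dL B₀ C₁ C₄ B₃ a₃ ε₁ ε₄ : ℝ) (hdL : 0 ≤ dL) (hB₀ : 0 ≤ B₀) (hC₁ : 0 ≤ C₁) (hC₄ : 0 ≤ C₄)
    (hε₁ : 0 ≤ ε₁) (hε₄ : 0 ≤ ε₄) (hB₃ : dL ≤ B₃) (h1 : 2 * B₀ * C₁ * B₃ * ε₁ ≤ ε₄) (h2 : 4 * ε₄ ≤ a₃)
    (h3 : 16 * B₀ * C₄ * ε₄ ≤ 1) :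
    (ε₄ + 2 * dL * B₀ * C₁ * ε₁ ≤ a₃ ∧
      B₀ * C₁ * B₃ * ε₁ + B₀ * C₄ * (ε₄ + 2 * dL * B₀ * C₁ * ε₁) ^ 2 ≤ ε₄) ∧
    (2 * ε₄ + 4 * dL * B₀ * C₁ * ε₁ ≤ a₃ ∧ 4 * B₀ * C₄ * (ε₄ + 2 * dL * B₀ * C₁ * ε₁) ≤ 1 / 2) := by
  have hd : 2 * dL * B₀ * C₁ * ε₁ ≤ 2 * B₃ * B₀ * C₁ * ε₁ := by
    have : dL * (B₀ * C₁ * ε₁) ≤ B₃ * (B₀ * C₁ * ε₁) := mul_le_mul_of_nonneg_right hB₃ (by positivity)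
    nlinarith
  have hs : ε₄ + 2 * dL * B₀ * C₁ * ε₁ ≤ 2 * ε₄ := by nlinarith
  have hs0 : 0 ≤ ε₄ + 2 * dL * B₀ * C₁ * ε₁ := by
    have : 0 ≤ 2 * dL * B₀ * C₁ * ε₁ := by positivity
    linarith
  have hsq : (ε₄ + 2 * dL * B₀ * C₁ * ε₁) ^ 2 ≤ (2 * ε₄) ^ 2 := pow_le_pow_left₀ hs0 hs 2
  have hsq' : B₀ * C₄ * (ε₄ + 2 * dL * B₀ * C₁ * ε₁) ^ 2 ≤ B₀ * C₄ * (2 * ε₄) ^ 2 :=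
    mul_le_mul_of_nonneg_left hsq (by positivity)
  have hprod : 16 * B₀ * C₄ * ε₄ * ε₄ ≤ 1 * ε₄ := mul_le_mul_of_nonneg_right h3 hε₄
  have hlin : 4 * B₀ * C₄ * (ε₄ + 2 * dL * B₀ * C₁ * ε₁) ≤ 4 * B₀ * C₄ * (2 * ε₄) :=
    mul_le_mul_of_nonneg_left hs (by positivity)
  refine ⟨⟨by linarith, by nlinarith⟩, ⟨by linarith, by nlinarith⟩⟩

/-- **(169)** p. 305 [29]: ¼MB₃ε₁ + ⅛M′B₃ε₁ < ½MB₃ε₁ for M′ ≤ M (M = M′R₁M₁, R₁M₁ ≥ 1) and B₃ε₁M > 0.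
[cite: Balaban1985Variational, (169) p.305] -/
theorem ineq169 (M M' B₃ ε₁ : ℝ) (hM : M' ≤ M) (hpos : 0 < M * B₃ * ε₁) (hB : 0 ≤ B₃ * ε₁) :
    M * B₃ * ε₁ / 4 + M' * B₃ * ε₁ / 8 < M * B₃ * ε₁ / 2 := by
  have : M' * (B₃ * ε₁) ≤ M * (B₃ * ε₁) := mul_le_mul_of_nonneg_right hM hB
  nlinarith

/-- p. 304 [28], the halving iteration (verbatim: *"If ½ε₀ > B₃ε₁, then we apply again the whole reasoning with ½ε₀
instead of ε₀. We continue this way until we reach the bound B₃ε₁."*): the sequence ε₀^{(n+1)} = max{B₃ε₁, ½ε₀^{(n)}}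
reaches B₃ε₁ after finitely many steps. [cite: Balaban1985Variational, p.304] -/
theorem halving_reaches_B3eps1 (ε₀ b : ℝ) (hb : 0 < b) : ∃ n : ℕ, max b (ε₀ / 2 ^ n) = b := by
  obtain ⟨n, hn⟩ := pow_unbounded_of_one_lt (ε₀ / b) (by norm_num : (1 : ℝ) < 2)
  refine ⟨n, max_eq_left ?_⟩
  have h2 : (0 : ℝ) < 2 ^ n := by positivity
  rw [div_le_iff₀ h2]
  have := (div_lt_iff₀ hb).1 hn
  linarith [mul_comm ((2 : ℝ) ^ n) b]

/-- **B₃ of (162)** p. 303 [27]: B₃ = 72d³L³B₀·S, S = sup_{ℭ_k} sup_{y₁} Σ_{y₂ ∈ ℭ_k} e^{−½δ₀d(y₁,y₂)}(d(y₁,y₂) + 1)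
(L^{j₂}η)^{−1} ("It follows from the inequalities (2.47)–(2.51) of [3] that B₃ depends on d and L only" — GAPS
G-B11-F2, by reference).  Since the y₂ = y₁ term gives S ≥ 1 and B₀ ≥ 1, B₃ ≥ 72d³L³ ≥ 4(d − 1), the size needed in
the k = 1 base case (U₀ = V₀ ∈ 𝔘₁(C₁B₃ε₁) from (7), GAPS G-B11-A2), and B₃ ≥ dL (used in `ineq118_121`).
[cite: Balaban1985Variational, (162) p.303] -/
theorem B3_lower_bounds (d L B₀ S : ℝ) (hd : 1 ≤ d) (hL : 1 ≤ L) (hB₀ : 1 ≤ B₀) (hS : 1 ≤ S) :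
    4 * (d - 1) ≤ 72 * d ^ 3 * L ^ 3 * B₀ * S ∧ d * L ≤ 72 * d ^ 3 * L ^ 3 * B₀ * S := by
  have hd3 : d ≤ d ^ 3 := by
    nlinarith [mul_nonneg (mul_nonneg (by linarith : (0 : ℝ) ≤ d) (by linarith : (0 : ℝ) ≤ d - 1))
      (by linarith : (0 : ℝ) ≤ d + 1)]
  have hL3 : L ≤ L ^ 3 := by
    nlinarith [mul_nonneg (mul_nonneg (by linarith : (0 : ℝ) ≤ L) (by linarith : (0 : ℝ) ≤ L - 1))
      (by linarith : (0 : ℝ) ≤ L + 1)]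
  have hdL : d * L ≤ d ^ 3 * L ^ 3 := mul_le_mul hd3 hL3 (by linarith) (by nlinarith)
  have h1 : d ^ 3 * L ^ 3 * 1 ≤ d ^ 3 * L ^ 3 * B₀ := mul_le_mul_of_nonneg_left hB₀ (by positivity)
  have h2 : d ^ 3 * L ^ 3 * B₀ * 1 ≤ d ^ 3 * L ^ 3 * B₀ * S := mul_le_mul_of_nonneg_left hS (by positivity)
  have hL3' : 1 ≤ L ^ 3 := one_le_pow₀ hL
  have h3 : d * 1 ≤ d * L ^ 3 := mul_le_mul_of_nonneg_left hL3' (by linarith)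
  constructor <;> nlinarith

/-- **Edge to [6] = B8, Theorem 2, as used on p. 280 [4]** (verbatim: *"Configurations U from the space (18), and
U₀, satisfy the assumptions (1.33)–(1.35) of this theorem with α₀ = ε₀, α₁ = C₁ε₁. The additional regularity
condition (3.35) in (1.33) is satisfied for U₀ also, because of the result of Sect. F. Thus for ε₀, ε₁ sufficiently
small, more exactly for ε₀ + C₁ε₁ ≤ c₁, and for an arbitrary configuration U = U′U₀ from (18) there exists exactly one
gauge transformation u satisfying \overline{R₀u}^j = 1 on Λ_j … such that U₁ = U′^{u⁻¹} satisfies the conditions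
(1.36)–(1.39) of [6]"*): the specialisation α₀ = ε₀, α₁ = C₁ε₁ of `B8.Thm2Printed`, with the hypothesis (3.35)
discharged exactly by an implication 𝔄_k(α₀) ⊂ Reg335(α₀) — the content of B8 Sect. F, Prop. 6 (`B8.Prop6Printed`,
`B8.thm2_exists_without_reg335`; constants GAPS G-B8-07); this locates the by-reference step (cell template T-G11:
"Sect. F" = Sect. F of [6], cf. p. 296 "the results of [6], especially those of the Sect. F").  (GAPS G-B11-A4: U₀ ∈
𝔄_k(ε₀) itself needs C₁B₃ε₁ ≤ ε₀.) [folklore] -/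
theorem p280_landau_gauge_of_B8Thm2 (fam : I → B8.GFData) (h : B8.Thm2Printed fam)
    (hreg : ∀ i α₀ (U₀ : (fam i).Cfg), (fam i).InA α₀ U₀ → (fam i).Reg335 α₀ U₀) (C₁ : ℝ) (hC₁ : 0 < C₁) :
    ∃ B₁ B₂ c₁ : ℝ, 0 < B₁ ∧ 0 < B₂ ∧ 0 < c₁ ∧
      ∀ i : I, ∀ ε₀ ε₁ : ℝ, 0 < ε₀ → 0 < ε₁ → ε₀ + C₁ * ε₁ ≤ c₁ →
        ∀ U₀ : (fam i).Cfg, ∀ U' : (fam i).Pert,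
          (fam i).InA ε₀ U₀ → (fam i).InAAx ε₀ U₀ U' → (fam i).avgClose (C₁ * ε₁) U₀ U' →
            ∃ u : (fam i).GT, (fam i).Restricted U₀ u ∧
              ((fam i).C136 B₁ B₂ (ε₀ + C₁ * ε₁) U₀ ((fam i).act U' u) ∧
                (fam i).C137 (C₁ * ε₁) U₀ ((fam i).act U' u) ∧
                (fam i).Landau U₀ ((fam i).act U' u) ∧ (fam i).C139 B₁ (ε₀ + C₁ * ε₁) U₀ ((fam i).act U' u)) ∧
              ∀ u' : (fam i).GT, (fam i).Restricted U₀ u' →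
                (fam i).C136 B₁ B₂ (ε₀ + C₁ * ε₁) U₀ ((fam i).act U' u') →
                (fam i).C137 (C₁ * ε₁) U₀ ((fam i).act U' u') →
                (fam i).Landau U₀ ((fam i).act U' u') → (fam i).C139 B₁ (ε₀ + C₁ * ε₁) U₀ ((fam i).act U' u') →
                  u' = u := by
  obtain ⟨B₁, B₂, c₁, hB₁, hB₂, hc₁, H⟩ := h
  refine ⟨B₁, B₂, c₁, hB₁, hB₂, hc₁, fun i ε₀ ε₁ h0 h1 hs U₀ U' hA hAx hcl => ?_⟩
  exact H i ε₀ (C₁ * ε₁) h0 (by positivity) hs U₀ U' hA (hreg i ε₀ U₀ hA) hAx hcl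

/-- **Edge to [6] = B8, Proposition 3**: the constant B₁ of (19), (103), (122) ("we have B₁ = 5dLB₀", p. 296 [20])
is the first Thm-2 constant of [6] Prop. 3 (`B8.Prop3Constants`). [cite: Balaban1985Variational, p.296] -/
theorem B1_eq_B8Prop3 (d : ℕ) (L : ℝ) (inp : B8.B9Inputs) (B₀β : ℝ) :
    (B8.Prop3Constants d L inp B₀β).1 = 5 * d * L * inp.B₀ := rfl

end SurgeB11

end Literature.MathematicalPhysics.QuantumFieldTheory.Balaban1983to89.B11
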